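import Summits.Ventures.Crystal3D.Theorems.StickyWulffConstantGenericWallFloorInPlaneSlots
import HarnessLib

/-!
# Every step of a slot line rises by `1/9`: the near-polar slot step and the in-plane case

HONEST FRAMING. Venture `Summits/Ventures/Crystal3D` (cell `crystal3d-full`), helper for the crux
`GenericWallFloor` (stmt-Ventures-19480) of `route-Ventures-StickyWulffConstant`, REGISTERED line `WallLedgerG`,
open stub `stub_twoSlabAdhesion` (general fillings; lines floor, memo LINES-FLOOR-ARCH v3 = evidence #54).
Rung credit only; F-C1 not moved.  THE RULE at a state `(x, F)` of `…DozenStep`: at a full-shell ball step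
along the steepest slot `u` (rise `≥ √2/2`); at a twin-dozen ball (normal `n`, far slots empty) step along a
NEAR-POLAR slot `w` (`⟪F w, n⟫ < 0`) or to its MIRROR `x + F w − 2⟪F w, n⟫ n`, whichever rises most.  Here:
* `exists_exact_neighbours_nearPolar_step` — after a near-polar slot step the new ball has three linearly
  independent exact slot neighbours (the four slots adjacent to a near-polar slot are own-side);
* `exists_rise_of_twinDozen` — for every unit `z` and slot `u` with `⟪F u, z⟫ ≥ √2/2` some near-polar `w`
  has `⟪F w, z⟫ ≥ 1/9` or `⟪F w − 2⟪F w, n⟫ n, z⟫ ≥ 1/9`.  Cases: `u` near-polar (itself); far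
  (`exists_capper_rise`); IN-PLANE — then `u` is a difference of two near-polar slots
  (`inPlane_eq_sub_of_nearPolar`, from the slot frame identity `Σ_w ⟪w, u⟫² = 4`: were `u` orthogonal to
  the polar triples, the six in-plane slots would carry the whole sum but carry at most `1 + 1 + 4·¼ = 3`)
  and the sum rule `F w₁ + F w₂ + F w₃ = −√6 n` finishes by the sign of `⟪n, z⟫` (`rise_aux`).
So with `…DozenStep` every state pays within contact distance `1` or has a successor higher by `≥ 1/9`.
WHAT THIS IS NOT: not the stub; no counting (in-degree, chain exclusion, assembly remain); F-C1 not moved.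
-/

noncomputable section

namespace Summit.Ventures.Crystal3D.Theorems

open Summit.Ventures.Crystal3D Finset
open Literature.MathematicalPhysics.StatisticalMechanics (fccStacking)
open scoped InnerProductSpace

variable {X : Finset (EuclideanSpace ℝ (Fin 3))}

/-! ### The near-polar slot step -/

/-- **Near-polar slot step.**  At a twin-dozen ball `y` (own side `⟪A w, n⟫ ≤ 0` occupied), for a
near-polar slot `w₀` (`⟪A w₀, n⟫ < 0`) the ball `y + A w₀` has three linearly independent exact slot
neighbours in the frame `A`. -/
theorem exists_exact_neighbours_nearPolar_step
    (A : EuclideanSpace ℝ (Fin 3) ≃ₗᵢ[ℝ] EuclideanSpace ℝ (Fin 3)) {y n : EuclideanSpace ℝ (Fin 3)}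
    (hy : y ∈ X)
    (hmenu : ∀ w ∈ fccSlots, ⟪A w, n⟫_ℝ = 0 ∨ ⟪A w, n⟫_ℝ = Real.sqrt (2 / 3) ∨ ⟪A w, n⟫_ℝ = -Real.sqrt (2 / 3))
    (hown : ∀ w ∈ fccSlots, ⟪A w, n⟫_ℝ ≤ 0 → y + A w ∈ X)
    {w₀ : EuclideanSpace ℝ (Fin 3)} (hw₀ : w₀ ∈ fccSlots) (hw₀n : ⟪A w₀, n⟫_ℝ < 0) :
    ∃ a ∈ fccSlots, ∃ b ∈ fccSlots, ∃ c ∈ fccSlots, LinearIndependent ℝ ![a, b, c] ∧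
      y + A w₀ + A a ∈ X ∧ y + A w₀ + A b ∈ X ∧ y + A w₀ + A c ∈ X := by
  have hrpos : 0 < Real.sqrt (2 / 3) := Real.sqrt_pos.2 (by norm_num)
  have hw₀v : ⟪A w₀, n⟫_ℝ = -Real.sqrt (2 / 3) := by
    rcases hmenu w₀ hw₀ with h | h | h
    · rw [h] at hw₀n; exact absurd hw₀n (lt_irrefl 0)
    · rw [h] at hw₀n; linarith
    · exact h
  have hAw : A w₀ ≠ 0 := by
    rw [← norm_ne_zero_iff, LinearIsometryEquiv.norm_map, norm_eq_one_of_mem_fccSlots hw₀]; norm_num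
  obtain ⟨a, ha, b, hb, c, hc, ha', hb', hc', hind⟩ := exists_independent_slots_of_hemisphere A hAw
  have occ : ∀ s ∈ fccSlots, ⟪A s, A w₀⟫_ℝ < 0 → y + A w₀ + A s ∈ X := by
    intro s hs hneg
    rw [LinearIsometryEquiv.inner_map_map] at hneg
    rcases eq_neg_or_add_mem_fccSlots_of_inner_neg hw₀ hs hneg with rfl | hsum
    · rw [map_neg, add_neg_cancel_right]; exact hy
    · rw [add_assoc, ← map_add]
      apply hown _ hsum
      have hle : ⟪A s, n⟫_ℝ ≤ Real.sqrt (2 / 3) := by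
        rcases hmenu s hs with h | h | h <;> rw [h] <;> linarith
      rw [map_add, inner_add_left, hw₀v]; linarith
  exact ⟨a, ha, b, hb, c, hc, hind, occ a ha ha', occ b hb hb', occ c hc hc'⟩

/-! ### The rise -/

/-- Arithmetic of the in-plane case: `ρa − ρb ≥ √2/2` and `ρa + ρb + ρc = −√6 α` give a slot rise
(`α ≤ 0`) or a mirror rise (`α ≥ 0`) of at least `1/9` at `a` or at `c`. -/
theorem rise_aux {ρa ρb ρc α : ℝ} (hsum : ρa + ρb + ρc = -(Real.sqrt 6 * α))
    (hs : Real.sqrt 2 / 2 ≤ ρa - ρb) :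
    (1 / 9 : ℝ) ≤ ρa ∨ (1 / 9 : ℝ) ≤ ρc ∨
      (1 / 9 : ℝ) ≤ ρa + 2 * Real.sqrt (2 / 3) * α ∨ (1 / 9 : ℝ) ≤ ρc + 2 * Real.sqrt (2 / 3) * α := by
  have h2 : (1.4 : ℝ) < Real.sqrt 2 := by
    rw [show (1.4 : ℝ) = Real.sqrt (1.4 ^ 2) by rw [Real.sqrt_sq (by norm_num)]]
    exact Real.sqrt_lt_sqrt (by norm_num) (by norm_num)
  have h62 : Real.sqrt 6 = 3 * Real.sqrt (2 / 3) := by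
    rw [show (6 : ℝ) = 3 ^ 2 * (2 / 3) by norm_num, Real.sqrt_mul (by norm_num), Real.sqrt_sq (by norm_num)]
  by_contra h
  push Not at h
  obtain ⟨h1, h2', h3, h4⟩ := h
  rcases le_or_gt α 0 with hα | hα
  · nlinarith [Real.sqrt_nonneg (2 / 3)]
  · nlinarith [Real.sqrt_nonneg (2 / 3)]

/-- **Every twin-dozen ball admits a rising near-polar move.**  `n` a unit `{111}` normal of the frame
`A`, `z` a unit vector, `u` a slot with `⟪A u, z⟫ ≥ √2/2`.  Then some NEAR-POLAR slot `w`
(`⟪A w, n⟫ < 0`) satisfies `⟪A w, z⟫ ≥ 1/9` (slot step) or `⟪A w − 2⟪A w, n⟫ n, z⟫ ≥ 1/9` (mirror step). -/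
theorem exists_rise_of_twinDozen
    (A : EuclideanSpace ℝ (Fin 3) ≃ₗᵢ[ℝ] EuclideanSpace ℝ (Fin 3)) {n z u : EuclideanSpace ℝ (Fin 3)}
    (hn : ‖n‖ = 1) (hz : ‖z‖ = 1)
    (hmenu : ∀ w ∈ fccSlots, ⟪A w, n⟫_ℝ = 0 ∨ ⟪A w, n⟫_ℝ = Real.sqrt (2 / 3) ∨ ⟪A w, n⟫_ℝ = -Real.sqrt (2 / 3))
    (hu : u ∈ fccSlots) (hsteep : Real.sqrt 2 / 2 ≤ ⟪A u, z⟫_ℝ) :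
    ∃ w ∈ fccSlots, ⟪A w, n⟫_ℝ < 0 ∧
      ((1 / 9 : ℝ) ≤ ⟪A w, z⟫_ℝ ∨ (1 / 9 : ℝ) ≤ ⟪A w - (2 * ⟪A w, n⟫_ℝ) • n, z⟫_ℝ) := by
  have hrpos : 0 < Real.sqrt (2 / 3) := Real.sqrt_pos.2 (by norm_num)
  have h2 : (1.4 : ℝ) < Real.sqrt 2 := by
    rw [show (1.4 : ℝ) = Real.sqrt (1.4 ^ 2) by rw [Real.sqrt_sq (by norm_num)]]
    exact Real.sqrt_lt_sqrt (by norm_num) (by norm_num)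
  have hn' : ‖-n‖ = 1 := by rw [norm_neg, hn]
  have hmenu' : ∀ w ∈ fccSlots, ⟪A w, -n⟫_ℝ = 0 ∨ ⟪A w, -n⟫_ℝ = Real.sqrt (2 / 3) ∨
      ⟪A w, -n⟫_ℝ = -Real.sqrt (2 / 3) := by
    intro w hw
    rcases hmenu w hw with h | h | h
    · exact Or.inl (by rw [inner_neg_right, h, neg_zero])
    · exact Or.inr (Or.inr (by rw [inner_neg_right, h]))
    · exact Or.inr (Or.inl (by rw [inner_neg_right, h, neg_neg]))
  -- the near-polar triple
  obtain ⟨w₁, hw₁, w₂, hw₂, w₃, hw₃, h12, h13, h23, e₁, e₂, e₃⟩ := exists_three_far_slots A hn' hmenu'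
  rw [inner_neg_right, neg_eq_iff_eq_neg] at e₁ e₂ e₃
  have mirror : ∀ {w}, ⟪A w, n⟫_ℝ = -Real.sqrt (2 / 3) →
      ⟪A w - (2 * ⟪A w, n⟫_ℝ) • n, z⟫_ℝ = ⟪A w, z⟫_ℝ + 2 * Real.sqrt (2 / 3) * ⟪n, z⟫_ℝ := by
    intro w hw
    rw [inner_sub_left, inner_smul_left, hw, conj_trivial]; ring
  rcases hmenu u hu with h0 | hpos | hneg
  · -- in-plane: `u = a − b` for near-polar `a, b`
    obtain ⟨a, ha, b, hb, hab⟩ := inPlane_eq_sub_of_nearPolar A hn hmenu hu h0 hw₁ hw₂ hw₃ h12 h13 h23 e₁ e₂ e₃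
    have slotA : ∀ {w}, w ∈ fccSlots → ‖A w‖ = 1 := fun hw => by
      rw [LinearIsometryEquiv.norm_map, norm_eq_one_of_mem_fccSlots hw]
    have hpair : ∀ {a b}, a ∈ fccSlots → b ∈ fccSlots → a ≠ b → ⟪A a, n⟫_ℝ = -Real.sqrt (2 / 3) →
        ⟪A b, n⟫_ℝ = -Real.sqrt (2 / 3) → ⟪A a, A b⟫_ℝ = 1 / 2 := by
      intro a b ha hb hab han hbn
      exact inner_eq_half_of_far_slots A (n := -n) ⟨_, mem_fcc_of_mem_fccSlots ha, rfl⟩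
        ⟨_, mem_fcc_of_mem_fccSlots hb, rfl⟩ (slotA ha) (slotA hb) hn'
        (by rw [inner_neg_right, han, neg_neg]) (by rw [inner_neg_right, hbn, neg_neg])
        (fun e => hab (A.injective e))
    have hsumvec : A w₁ + A w₂ + A w₃ = Real.sqrt 6 • (-n) :=
      sum_eq_sqrt_six_smul (A w₁) (A w₂) (A w₃) (-n) (slotA hw₁) (slotA hw₂) (slotA hw₃) hn'
        (hpair hw₁ hw₂ h12 e₁ e₂) (hpair hw₁ hw₃ h13 e₁ e₃) (hpair hw₂ hw₃ h23 e₂ e₃)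
        (by rw [inner_neg_right, e₁, neg_neg]) (by rw [inner_neg_right, e₂, neg_neg])
        (by rw [inner_neg_right, e₃, neg_neg])
    have hsum : ⟪A w₁, z⟫_ℝ + ⟪A w₂, z⟫_ℝ + ⟪A w₃, z⟫_ℝ = -(Real.sqrt 6 * ⟪n, z⟫_ℝ) := by
      rw [← inner_add_left, ← inner_add_left, hsumvec, inner_smul_left, inner_neg_left]; simp
    have hdiff : ⟪A u, z⟫_ℝ = ⟪A a, z⟫_ℝ - ⟪A b, z⟫_ℝ := by rw [hab, map_sub, inner_sub_left]
    rw [hdiff] at hsteep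
    -- which pair?
    simp only [Finset.mem_insert, Finset.mem_singleton] at ha hb
    have fin : ∀ {a b c : EuclideanSpace ℝ (Fin 3)}, a ∈ fccSlots → c ∈ fccSlots →
        ⟪A a, n⟫_ℝ = -Real.sqrt (2 / 3) → ⟪A c, n⟫_ℝ = -Real.sqrt (2 / 3) →
        ⟪A a, z⟫_ℝ + ⟪A b, z⟫_ℝ + ⟪A c, z⟫_ℝ = -(Real.sqrt 6 * ⟪n, z⟫_ℝ) →
        Real.sqrt 2 / 2 ≤ ⟪A a, z⟫_ℝ - ⟪A b, z⟫_ℝ →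
        ∃ w ∈ fccSlots, ⟪A w, n⟫_ℝ < 0 ∧
          ((1 / 9 : ℝ) ≤ ⟪A w, z⟫_ℝ ∨ (1 / 9 : ℝ) ≤ ⟪A w - (2 * ⟪A w, n⟫_ℝ) • n, z⟫_ℝ) := by
      intro a b c ha hc han hcn hs hst
      rcases rise_aux hs hst with h | h | h | h
      · exact ⟨a, ha, by rw [han]; linarith, Or.inl h⟩
      · exact ⟨c, hc, by rw [hcn]; linarith, Or.inl h⟩
      · exact ⟨a, ha, by rw [han]; linarith, Or.inr (by rw [mirror han]; exact h)⟩
      · exact ⟨c, hc, by rw [hcn]; linarith, Or.inr (by rw [mirror hcn]; exact h)⟩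
    rcases ha with rfl | rfl | rfl <;> rcases hb with rfl | rfl | rfl
    · norm_num at hsteep; linarith
    · exact fin hw₁ hw₃ e₁ e₃ hsum hsteep
    · exact fin hw₁ hw₂ e₁ e₂ (by linarith) hsteep
    · exact fin hw₂ hw₃ e₂ e₃ (by linarith) hsteep
    · norm_num at hsteep; linarith
    · exact fin hw₂ hw₁ e₂ e₁ (by linarith) hsteep
    · exact fin hw₃ hw₂ e₃ e₂ (by linarith) hsteep
    · exact fin hw₃ hw₁ e₃ e₁ (by linarith) hsteep
    · norm_num at hsteep; linarith
  · -- far: the best capper of `exists_capper_rise`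
    have f₁ : ⟪A (-w₁), n⟫_ℝ = Real.sqrt (2 / 3) := by rw [map_neg, inner_neg_left, e₁, neg_neg]
    have f₂ : ⟪A (-w₂), n⟫_ℝ = Real.sqrt (2 / 3) := by rw [map_neg, inner_neg_left, e₂, neg_neg]
    have f₃ : ⟪A (-w₃), n⟫_ℝ = Real.sqrt (2 / 3) := by rw [map_neg, inner_neg_left, e₃, neg_neg]
    obtain ⟨w, hw, hrise⟩ := exists_capper_rise A hn hz hu hpos hsteep (neg_mem_fccSlots hw₁)
      (neg_mem_fccSlots hw₂) (neg_mem_fccSlots hw₃) (by simpa using h12) (by simpa using h13)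
      (by simpa using h23) f₁ f₂ f₃
    simp only [Finset.mem_insert, Finset.mem_singleton] at hw
    have key : ∀ {v}, v ∈ fccSlots → ⟪A v, n⟫_ℝ = -Real.sqrt (2 / 3) →
        (1 / 9 : ℝ) ≤ ⟪-A (-v) + (2 * Real.sqrt (2 / 3)) • n, z⟫_ℝ →
        ∃ w ∈ fccSlots, ⟪A w, n⟫_ℝ < 0 ∧
          ((1 / 9 : ℝ) ≤ ⟪A w, z⟫_ℝ ∨ (1 / 9 : ℝ) ≤ ⟪A w - (2 * ⟪A w, n⟫_ℝ) • n, z⟫_ℝ) := by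
      intro v hv hvn h
      refine ⟨v, hv, by rw [hvn]; linarith, Or.inr ?_⟩
      rw [hvn]
      rw [map_neg, neg_neg] at h
      convert h using 2; simp [sub_eq_add_neg, neg_smul]
    rcases hw with rfl | rfl | rfl
    · exact key hw₁ e₁ hrise
    · exact key hw₂ e₂ hrise
    · exact key hw₃ e₃ hrise
  · -- near-polar: `u` itself
    exact ⟨u, hu, by rw [hneg]; linarith, Or.inl (by linarith)⟩

end Summit.Ventures.Crystal3D.Theorems

end
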